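/-
Copyright (c) 2026 the pub-hodgecm-mathlib formalisation cell (harness21).  Prover seat hodgecm-mathlib-K2E4-p07 (g2),
Track B «K2-LIT» ∕ h413, unit «FinGermConstants» of the line `K2_E4_SingularTransferKappaSign`, socket #7R
`K2E4SingularTransferKappaSign.FinGermConstants.sig_K2E3GermConstantRegularHR` (ED. 4) BY NAME: for the pinned explicit factor `Δ‴` SOME smooth transfer pair charges
`γ_{H,v}` at EVERY finite place `v`.  2026-09-03.
-/
import Summits.HodgeConjecture.HodgeConjecture.Theorems.K2E3GermConstantRegularHRSplit            -- ★ p854983 (g0): split places + the socket's FRAME imports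
import Summits.HodgeConjecture.HodgeConjecture.Theorems.K2E3GermConstantRegularHRDescentWitness   -- ★ p855140 (g2): STEP (i)
import Summits.HodgeConjecture.HodgeConjecture.Theorems.K2E3GermConstantRegularHRDockSideOnly     -- ★ p855207 (g2): STEP (ii)
import Summits.HodgeConjecture.HodgeConjecture.Theorems.K2E3GermConstantRegularHRLocalPair        -- ★ p855223 (g2): STEP (iii)
import Summits.HodgeConjecture.HodgeConjecture.Theorems.K2E3GermConstantRegularHRNearCentral      -- ★ p855254 (K2E4-p04 (g2)): STEP (iv) window + ★ p854913 patch, docking form `…_of_nhds_finExplicitCollection`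
import Literature.NumberTheory.Rogawski1990.LocalEndoscopicCentralDockCM                        -- ★ `exists_centralDock_of_fst_eq_smul_one`
import Literature.NumberTheory.Rogawski1990.LocalNormFibreBadFrame                              -- ★ `exists_badFrame_dock`
import Literature.NumberTheory.Rogawski1990.LocalEndoscopicDockSeparation                       -- ★ `exists_nhds_stablySaturated_sep_dock`
import Literature.NumberTheory.Rogawski1990.FinExplicitTransferFactorDockConstancy               -- ★ `exists_nhds_finExplicitDelta_dock_eq`
import Literature.NumberTheory.Rogawski1990.AdelicStableOrbitalCentralH                          -- ★ `coe_coe_cmDatum_toLocal_toAdelic_eq_smul_one_of_smul_one`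
import Literature.NumberTheory.Rogawski1990.AdelicStableOrbitalEulerDischargeSemisimple          -- ★ `coe_toLocal_toAdelic_eq_map`
import Literature.NumberTheory.Rogawski1990.UnitFundamentalLemmaExplicitNonsplitOfPlaces         -- ★ `smul_eq_of_subsingleton_placesOver`
import Literature.NumberTheory.Rogawski1990.UnramifiedStableOrbitalUnitFactorSemisimple          -- ★ `classOrbitalIntegral_eq_zero_of_forall_conj_eq_zero`
import Literature.NumberTheory.Rogawski1990.RankOneEulerPoincareGlue                             -- ★ `IsLocSmooth.const_smul`
import HarnessLib

/-!
# K2_E4 road (h413 = stmt-HodgeConjecture-24833), unit «FinGermConstants», socket #7R **`sig_K2E3GermConstantRegularHR`** BY NAME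

Cell `pub/hodgecm-mathlib` (D-0151), Track B «K2-LIT» (21-frontier RULING «PUSH BOTH» 2026-09-03); socket module
`Summits/HodgeConjecture/HodgeConjecture/Cruxes/H413/Lines/K2_E4_SingularTransferKappaSignSigsFinGermConstants.lean` (ED. 4, :309), socket
`sig_K2E3GermConstantRegularHR` (R-twin of #7, chair RULING R11; OWNER K2E3, host K2E4-plan, base K2E4-p07): under the letters' frame, for the PINNED data
(`μ`, `Δ = Δ‴ := finExplicitCollection μ`, `Tinf`), the singular rational class `γ₀` with `χ_{γ₀} = (X − e₁)²(X − e₂)` and its `H`-partner `γ_H = (e₁·1₂, e₂)`, at EVERY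
finite place `v` there is a smooth `Δ‴_v`-transfer pair `(f^H, f)` with `f^H(γ_{H,v}) ≠ 0` [Rogawski1990 Prop. 8.2.1 (a) p. 118 ⟸ Prop. 8.1.3 p. 116; Lemma 4.13.1 (a) p. 70].

THE PROOF.  SPLIT `v`: ★ `K2E3GermConstantRegularHRSplit.germConstantRegularHR_of_not_subsingleton` (p854983).  NON-SPLIT `v` (in or out of `S_bad`): `γ_{H,v} = ε_H = (a·1₂, u)`
with `a = e₁ ⊗ 1`, `u = e₂ ⊗ 1 ≠ a`; take the central dock `θ : H_v ≃ₜ* Z(ε)` (★ `exists_centralDock_of_fst_eq_smul_one`) and a bad frame `P′` (★ `exists_badFrame_dock`).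
(ii) ★ `K2E3GermConstantRegularHRDockSideOnly`: a neighbourhood `N × U` of `(ε_H, ε)` whose matched pairs are all on the dock side; shrink `U` to a compact open `U′ ∋ ε` and
let `φ := 1_{U′}`.  (i) ★ `K2E3GermConstantRegularHRDescentWitness`: Harish-Chandra descent `φ_ε` of `φ` at `ε` on a stably saturated `B ∋ ε_H`, with `φ_ε(ε_H) ≠ 0`.
(iii) ★ `K2E3GermConstantRegularHRLocalPair`: since the `Q′`-side classes of `γ_H ∈ N` do not meet `U′` (a conjugate in `U′` would be a matched element of `U` on the
`Q′`-side), `(Δ₀ • φ_ε, φ)` satisfies (4.3.1) at the `G`-regular points of some `V ∈ 𝓝 ε_H`, `Δ₀ = Δ‴_v(ε_H, ε) ≠ 0` (★ `finExplicitDelta_ne_zero_of_isUnit`).  (iv) ★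
`K2E3GermConstantRegularHRNearCentral` (p855254, K2E4-p04 (g2)): a CLOPEN, STABLY SATURATED window `W ∋ ε_H` all of whose `G`-regular points are stably conjugate into `V`
(both sides of (4.3.1) are stable-class functions), patched by ★ `K2E3GermConstantRegularHRLocalReduction` (p854913) with any transfer of `φ` off `W` (★ `IsLocalDeltaTransferExists`
from `hCTM`) into a smooth transfer pair `(f^H, φ)` with `f^H(ε_H) = Δ₀ φ_ε(ε_H) ≠ 0` — all inside its docking form `exists_transferPair_apply_ne_zero_of_nhds_finExplicitCollection`.
The Haar property of `νH v` is obtained as in p854983.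

* **`germConstantRegularHR`** — `sig_K2E3GermConstantRegularHR`'s statement VERBATIM (frame binders byte-for-byte from the socket module), proved.

HONEST LABEL: HC_CM is proved only modulo the 7 printed citations (2 remaining named inputs: hLiu418 = stmt-HodgeConjecture-24832, h413 =
stmt-HodgeConjecture-24833) until rung 0 closes; this file pays the tier-1 socket #7R of the line `K2_E4_SingularTransferKappaSign` as a `--supports stmt-HodgeConjecture-24833`
helper; it does not close the crux item.
-/

set_option autoImplicit false
set_option linter.dupNamespace false

noncomputable section

open MeasureTheory Measure NumberField IsDedekindDomain TopologicalSpace Topology Filter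
open Literature.MeasureTheory.Group Literature.MeasureTheory.RestrictedProduct
open Literature.Topology.RestrictedProduct Literature.Topology.Algebra.RestrictedProduct
open Literature.NumberTheory.Rogawski1990 Literature.NumberTheory.Automorphic Literature.NumberTheory.GaloisRepresentations
open Literature.AlgebraicGeometry.ShimuraVarieties (unitaryGroup hermForm)
open scoped Matrix MatrixGroups NNReal ENNReal Pointwise RestrictedProduct

namespace Summit.HodgeConjecture.HodgeConjecture.Cruxes.H413.K2E3GermConstantRegularHR

section Frame

variable (L : Type) [Field L] [NumberField L] [IsCMField L]

variable (H' : Matrix (Fin 3) (Fin 3) L) (Tinf : ArchTransferFactor L H')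
    -- σ-algebras of the `G′` side (★ (O10-c5) block), of `H_v`, `G_∞`, `H_∞`, and the Haar data — EXACTLY ★ `SingularEllipticTransfer`'s binders
    [∀ γ : UnitaryGroup.arch (↥(maximalRealSubfield L)) L (IsCMField.complexConj L) 3 H',
      MeasurableSpace (UnitaryGroup.arch (↥(maximalRealSubfield L)) L (IsCMField.complexConj L) 3 H' ⧸ Subgroup.centralizer ({γ} : Set (UnitaryGroup.arch (↥(maximalRealSubfield L)) L (IsCMField.complexConj L) 3 H')))]
    [∀ γ : UnitaryGroup.arch (↥(maximalRealSubfield L)) L (IsCMField.complexConj L) 3 H',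
      BorelSpace (UnitaryGroup.arch (↥(maximalRealSubfield L)) L (IsCMField.complexConj L) 3 H' ⧸ Subgroup.centralizer ({γ} : Set (UnitaryGroup.arch (↥(maximalRealSubfield L)) L (IsCMField.complexConj L) 3 H')))]
    [∀ (v : HeightOneSpectrum (𝓞 ↥(maximalRealSubfield L))) (γ : (UnitaryGroup.cmDatum L 3 H').Local v),
      MeasurableSpace ((UnitaryGroup.cmDatum L 3 H').Local v ⧸ Subgroup.centralizer ({γ} : Set ((UnitaryGroup.cmDatum L 3 H').Local v)))]
    [∀ (v : HeightOneSpectrum (𝓞 ↥(maximalRealSubfield L))) (γ : (UnitaryGroup.cmDatum L 3 H').Local v),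
      BorelSpace ((UnitaryGroup.cmDatum L 3 H').Local v ⧸ Subgroup.centralizer ({γ} : Set ((UnitaryGroup.cmDatum L 3 H').Local v)))]
    [∀ v : HeightOneSpectrum (𝓞 ↥(maximalRealSubfield L)), MeasurableSpace ((UnitaryGroup.cmDatum L 3 H').Local v)] [∀ v : HeightOneSpectrum (𝓞 ↥(maximalRealSubfield L)), BorelSpace ((UnitaryGroup.cmDatum L 3 H').Local v)]
    [MeasurableSpace (UnitaryGroup.arch (↥(maximalRealSubfield L)) L (IsCMField.complexConj L) 3 H')] [BorelSpace (UnitaryGroup.arch (↥(maximalRealSubfield L)) L (IsCMField.complexConj L) 3 H')]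
    [∀ v : HeightOneSpectrum (𝓞 ↥(maximalRealSubfield L)), MeasurableSpace ((UnitaryGroup.cmDatum L 2 (Matrix.of fun i j : Fin 2 => if i.val + j.val + 1 = 2 then (1 : L) else 0)).Local v ×
        (UnitaryGroup.cmDatum L 1 (Matrix.of fun i j : Fin 1 => if i.val + j.val + 1 = 1 then (1 : L) else 0)).Local v)]
    [∀ v : HeightOneSpectrum (𝓞 ↥(maximalRealSubfield L)), BorelSpace ((UnitaryGroup.cmDatum L 2 (Matrix.of fun i j : Fin 2 => if i.val + j.val + 1 = 2 then (1 : L) else 0)).Local v ×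
        (UnitaryGroup.cmDatum L 1 (Matrix.of fun i j : Fin 1 => if i.val + j.val + 1 = 1 then (1 : L) else 0)).Local v)]
    [∀ (v : HeightOneSpectrum (𝓞 ↥(maximalRealSubfield L))) (a : ((UnitaryGroup.cmDatum L 2 (Matrix.of fun i j : Fin 2 => if i.val + j.val + 1 = 2 then (1 : L) else 0)).Local v ×
        (UnitaryGroup.cmDatum L 1 (Matrix.of fun i j : Fin 1 => if i.val + j.val + 1 = 1 then (1 : L) else 0)).Local v)),
      MeasurableSpace (((UnitaryGroup.cmDatum L 2 (Matrix.of fun i j : Fin 2 => if i.val + j.val + 1 = 2 then (1 : L) else 0)).Local v ×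
        (UnitaryGroup.cmDatum L 1 (Matrix.of fun i j : Fin 1 => if i.val + j.val + 1 = 1 then (1 : L) else 0)).Local v) ⧸ Subgroup.centralizer ({a} : Set ((UnitaryGroup.cmDatum L 2 (Matrix.of fun i j : Fin 2 => if i.val + j.val + 1 = 2 then (1 : L) else 0)).Local v ×
        (UnitaryGroup.cmDatum L 1 (Matrix.of fun i j : Fin 1 => if i.val + j.val + 1 = 1 then (1 : L) else 0)).Local v)))]
    [∀ (v : HeightOneSpectrum (𝓞 ↥(maximalRealSubfield L))) (a : ((UnitaryGroup.cmDatum L 2 (Matrix.of fun i j : Fin 2 => if i.val + j.val + 1 = 2 then (1 : L) else 0)).Local v ×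
        (UnitaryGroup.cmDatum L 1 (Matrix.of fun i j : Fin 1 => if i.val + j.val + 1 = 1 then (1 : L) else 0)).Local v)),
      BorelSpace (((UnitaryGroup.cmDatum L 2 (Matrix.of fun i j : Fin 2 => if i.val + j.val + 1 = 2 then (1 : L) else 0)).Local v ×
        (UnitaryGroup.cmDatum L 1 (Matrix.of fun i j : Fin 1 => if i.val + j.val + 1 = 1 then (1 : L) else 0)).Local v) ⧸ Subgroup.centralizer ({a} : Set ((UnitaryGroup.cmDatum L 2 (Matrix.of fun i j : Fin 2 => if i.val + j.val + 1 = 2 then (1 : L) else 0)).Local v ×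
        (UnitaryGroup.cmDatum L 1 (Matrix.of fun i j : Fin 1 => if i.val + j.val + 1 = 1 then (1 : L) else 0)).Local v)))]
    [MeasurableSpace (UnitaryGroup.arch (↥(maximalRealSubfield L)) L (IsCMField.complexConj L) 3 (Matrix.of fun i j : Fin 3 => if i.val + j.val + 1 = 3 then (1 : L) else 0))] [BorelSpace (UnitaryGroup.arch (↥(maximalRealSubfield L)) L (IsCMField.complexConj L) 3 (Matrix.of fun i j : Fin 3 => if i.val + j.val + 1 = 3 then (1 : L) else 0))]
    [∀ γ : UnitaryGroup.arch (↥(maximalRealSubfield L)) L (IsCMField.complexConj L) 3 (Matrix.of fun i j : Fin 3 => if i.val + j.val + 1 = 3 then (1 : L) else 0),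
      MeasurableSpace (UnitaryGroup.arch (↥(maximalRealSubfield L)) L (IsCMField.complexConj L) 3 (Matrix.of fun i j : Fin 3 => if i.val + j.val + 1 = 3 then (1 : L) else 0) ⧸ Subgroup.centralizer ({γ} : Set (UnitaryGroup.arch (↥(maximalRealSubfield L)) L (IsCMField.complexConj L) 3 (Matrix.of fun i j : Fin 3 => if i.val + j.val + 1 = 3 then (1 : L) else 0))))]
    [∀ γ : UnitaryGroup.arch (↥(maximalRealSubfield L)) L (IsCMField.complexConj L) 3 (Matrix.of fun i j : Fin 3 => if i.val + j.val + 1 = 3 then (1 : L) else 0),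
      BorelSpace (UnitaryGroup.arch (↥(maximalRealSubfield L)) L (IsCMField.complexConj L) 3 (Matrix.of fun i j : Fin 3 => if i.val + j.val + 1 = 3 then (1 : L) else 0) ⧸ Subgroup.centralizer ({γ} : Set (UnitaryGroup.arch (↥(maximalRealSubfield L)) L (IsCMField.complexConj L) 3 (Matrix.of fun i j : Fin 3 => if i.val + j.val + 1 = 3 then (1 : L) else 0))))]
    [MeasurableSpace (UnitaryGroup.arch (↥(maximalRealSubfield L)) L (IsCMField.complexConj L) 2 (Matrix.of fun i j : Fin 2 => if i.val + j.val + 1 = 2 then (1 : L) else 0) ×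
          UnitaryGroup.arch (↥(maximalRealSubfield L)) L (IsCMField.complexConj L) 1 (Matrix.of fun i j : Fin 1 => if i.val + j.val + 1 = 1 then (1 : L) else 0))]
    [BorelSpace (UnitaryGroup.arch (↥(maximalRealSubfield L)) L (IsCMField.complexConj L) 2 (Matrix.of fun i j : Fin 2 => if i.val + j.val + 1 = 2 then (1 : L) else 0) ×
          UnitaryGroup.arch (↥(maximalRealSubfield L)) L (IsCMField.complexConj L) 1 (Matrix.of fun i j : Fin 1 => if i.val + j.val + 1 = 1 then (1 : L) else 0))]
    [∀ a : (UnitaryGroup.arch (↥(maximalRealSubfield L)) L (IsCMField.complexConj L) 2 (Matrix.of fun i j : Fin 2 => if i.val + j.val + 1 = 2 then (1 : L) else 0) ×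
          UnitaryGroup.arch (↥(maximalRealSubfield L)) L (IsCMField.complexConj L) 1 (Matrix.of fun i j : Fin 1 => if i.val + j.val + 1 = 1 then (1 : L) else 0)),
      MeasurableSpace ((UnitaryGroup.arch (↥(maximalRealSubfield L)) L (IsCMField.complexConj L) 2 (Matrix.of fun i j : Fin 2 => if i.val + j.val + 1 = 2 then (1 : L) else 0) ×
          UnitaryGroup.arch (↥(maximalRealSubfield L)) L (IsCMField.complexConj L) 1 (Matrix.of fun i j : Fin 1 => if i.val + j.val + 1 = 1 then (1 : L) else 0)) ⧸ Subgroup.centralizer ({a} : Set (UnitaryGroup.arch (↥(maximalRealSubfield L)) L (IsCMField.complexConj L) 2 (Matrix.of fun i j : Fin 2 => if i.val + j.val + 1 = 2 then (1 : L) else 0) ×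
          UnitaryGroup.arch (↥(maximalRealSubfield L)) L (IsCMField.complexConj L) 1 (Matrix.of fun i j : Fin 1 => if i.val + j.val + 1 = 1 then (1 : L) else 0))))]
    [∀ a : (UnitaryGroup.arch (↥(maximalRealSubfield L)) L (IsCMField.complexConj L) 2 (Matrix.of fun i j : Fin 2 => if i.val + j.val + 1 = 2 then (1 : L) else 0) ×
          UnitaryGroup.arch (↥(maximalRealSubfield L)) L (IsCMField.complexConj L) 1 (Matrix.of fun i j : Fin 1 => if i.val + j.val + 1 = 1 then (1 : L) else 0)),
      BorelSpace ((UnitaryGroup.arch (↥(maximalRealSubfield L)) L (IsCMField.complexConj L) 2 (Matrix.of fun i j : Fin 2 => if i.val + j.val + 1 = 2 then (1 : L) else 0) ×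
          UnitaryGroup.arch (↥(maximalRealSubfield L)) L (IsCMField.complexConj L) 1 (Matrix.of fun i j : Fin 1 => if i.val + j.val + 1 = 1 then (1 : L) else 0)) ⧸ Subgroup.centralizer ({a} : Set (UnitaryGroup.arch (↥(maximalRealSubfield L)) L (IsCMField.complexConj L) 2 (Matrix.of fun i j : Fin 2 => if i.val + j.val + 1 = 2 then (1 : L) else 0) ×
          UnitaryGroup.arch (↥(maximalRealSubfield L)) L (IsCMField.complexConj L) 1 (Matrix.of fun i j : Fin 1 => if i.val + j.val + 1 = 1 then (1 : L) else 0))))]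
    (νH : ∀ v : HeightOneSpectrum (𝓞 ↥(maximalRealSubfield L)), Measure ((UnitaryGroup.cmDatum L 2 (Matrix.of fun i j : Fin 2 => if i.val + j.val + 1 = 2 then (1 : L) else 0)).Local v ×
        (UnitaryGroup.cmDatum L 1 (Matrix.of fun i j : Fin 1 => if i.val + j.val + 1 = 1 then (1 : L) else 0)).Local v))
    (νG : ∀ v : HeightOneSpectrum (𝓞 ↥(maximalRealSubfield L)), Measure ((UnitaryGroup.cmDatum L 3 H').Local v))
    [∀ v, IsFiniteMeasureOnCompacts (νH v)] [∀ v, (νH v).IsMulRightInvariant]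
    [∀ v, (νG v).IsHaarMeasure] [∀ v, (νG v).IsMulRightInvariant]  -- MAIN-b's strength (F2): `νG_v` Haar
    (νGi : Measure (UnitaryGroup.arch (↥(maximalRealSubfield L)) L (IsCMField.complexConj L) 3 H')) (νqi : Measure (UnitaryGroup.arch (↥(maximalRealSubfield L)) L (IsCMField.complexConj L) 3 (Matrix.of fun i j : Fin 3 => if i.val + j.val + 1 = 3 then (1 : L) else 0)))
    (νHi : Measure (UnitaryGroup.arch (↥(maximalRealSubfield L)) L (IsCMField.complexConj L) 2 (Matrix.of fun i j : Fin 2 => if i.val + j.val + 1 = 2 then (1 : L) else 0) ×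
          UnitaryGroup.arch (↥(maximalRealSubfield L)) L (IsCMField.complexConj L) 1 (Matrix.of fun i j : Fin 1 => if i.val + j.val + 1 = 1 then (1 : L) else 0)))
    [IsFiniteMeasureOnCompacts νGi] [νGi.IsMulRightInvariant] [IsFiniteMeasureOnCompacts νqi] [νqi.IsMulRightInvariant]
    [IsFiniteMeasureOnCompacts νHi] [νHi.IsMulRightInvariant]

/-- **`sig_K2E3GermConstantRegularHR` (FinGermConstants ED. 3∕4 :309), binders token for token, PROVED**: for the pinned explicit factor `Δ‴` (`hΔ`), at every finite place
`v` some smooth `Δ‴_v`-transfer pair `(f^H, f)` charges the central partner `γ_{H,v} = (e₁·1₂, e₂)_v` of the singular class `γ₀`: split `v` by ★ p854983, non-split `v` by the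
dock-side descent of STEPS (i)–(iv) patched by ★ p854913.  See the module docstring.
[cite: Rogawski1990, §8.2 Prop. 8.2.1 (a) p. 118; §8.1 Prop. 8.1.3 p. 116; §4.13 Lemma 4.13.1 (a) p. 70; §4.3 (4.3.1) p. 43; §4.9 Prop. 4.9.1 (a) p. 55]
[cite: LanglandsShelstad1990Descent, §2.2 Lemma 2.2.A p. 11; Thm. 2.3.A, §2.4] [cite: HarishChandra1970, Part I §3 Lemmas 19–23] -/
theorem germConstantRegularHR :
        ∀ (hK : ∀ v : HeightOneSpectrum (𝓞 ↥(maximalRealSubfield L)), νG v (UnitaryGroup.cmLocalIntegralLevel L 3 H' v : Set ((UnitaryGroup.cmDatum L 3 H').Local v)) = 1)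
          (hanis : ∀ x : Fin 3 → L, hermForm (cmConjRingHom L) H' x x = 0 → x = 0)
          (Sbad : Finset (HeightOneSpectrum (𝓞 ↥(maximalRealSubfield L))))
              (Δ : ∀ v : HeightOneSpectrum (𝓞 ↥(maximalRealSubfield L)), LocalTransferFactor L H' v)
              (mH : ∀ v : HeightOneSpectrum (𝓞 ↥(maximalRealSubfield L)),
                OrbitalMeasureFamily ((UnitaryGroup.cmDatum L 2 (Matrix.of fun i j : Fin 2 => if i.val + j.val + 1 = 2 then (1 : L) else 0)).Local v ×
                  (UnitaryGroup.cmDatum L 1 (Matrix.of fun i j : Fin 1 => if i.val + j.val + 1 = 1 then (1 : L) else 0)).Local v))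
              (mG : ∀ v : HeightOneSpectrum (𝓞 ↥(maximalRealSubfield L)), OrbitalMeasureFamily ((UnitaryGroup.cmDatum L 3 H').Local v))
          (m' : OrbitalMeasureFamily (UnitaryGroup.arch (↥(maximalRealSubfield L)) L (IsCMField.complexConj L) 3 H'))
                (m : OrbitalMeasureFamily (UnitaryGroup.arch (↥(maximalRealSubfield L)) L (IsCMField.complexConj L) 3
                  (Matrix.of fun i j : Fin 3 => if i.val + j.val + 1 = 3 then (1 : L) else 0)))
                (mHi : OrbitalMeasureFamily (UnitaryGroup.arch (↥(maximalRealSubfield L)) L (IsCMField.complexConj L) 2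
                    (Matrix.of fun i j : Fin 2 => if i.val + j.val + 1 = 2 then (1 : L) else 0) ×
                  UnitaryGroup.arch (↥(maximalRealSubfield L)) L (IsCMField.complexConj L) 1
                    (Matrix.of fun i j : Fin 1 => if i.val + j.val + 1 = 1 then (1 : L) else 0)))
                (t' : ∀ γ' : UnitaryGroup.arch (↥(maximalRealSubfield L)) L (IsCMField.complexConj L) 3 H',
                  Measure (Subgroup.centralizer ({γ'} : Set (UnitaryGroup.arch (↥(maximalRealSubfield L)) L (IsCMField.complexConj L) 3 H'))))
                (t : ∀ γ : UnitaryGroup.arch (↥(maximalRealSubfield L)) L (IsCMField.complexConj L) 3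
                    (Matrix.of fun i j : Fin 3 => if i.val + j.val + 1 = 3 then (1 : L) else 0),
                  Measure (Subgroup.centralizer ({γ} : Set (UnitaryGroup.arch (↥(maximalRealSubfield L)) L (IsCMField.complexConj L) 3
                    (Matrix.of fun i j : Fin 3 => if i.val + j.val + 1 = 3 then (1 : L) else 0)))))
                (tH : ∀ γH : UnitaryGroup.arch (↥(maximalRealSubfield L)) L (IsCMField.complexConj L) 2
                      (Matrix.of fun i j : Fin 2 => if i.val + j.val + 1 = 2 then (1 : L) else 0) ×
                    UnitaryGroup.arch (↥(maximalRealSubfield L)) L (IsCMField.complexConj L) 1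
                      (Matrix.of fun i j : Fin 1 => if i.val + j.val + 1 = 1 then (1 : L) else 0),
                  Measure (Subgroup.centralizer ({γH} : Set (UnitaryGroup.arch (↥(maximalRealSubfield L)) L (IsCMField.complexConj L) 2
                      (Matrix.of fun i j : Fin 2 => if i.val + j.val + 1 = 2 then (1 : L) else 0) ×
                    UnitaryGroup.arch (↥(maximalRealSubfield L)) L (IsCMField.complexConj L) 1
                      (Matrix.of fun i j : Fin 1 => if i.val + j.val + 1 = 1 then (1 : L) else 0)))))
            (hherm : (H'.map (cmConjRingHom L)).transpose = H')
            (hCTM : CanonicalTransferMatrix L H' Tinf.Δ νH νG Sbad Δ mH mG)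
            (hACS : ArchCanonicalSingularMatrix L H' Tinf νGi νqi νHi hanis m' m mHi t' t tH),
    ∀ (μ : Literature.NumberTheory.GaloisRepresentations.HeckeCharacter L) (hμu : μ.IsUnitary)
      (hμω : ∀ x : Literature.NumberTheory.GaloisRepresentations.ideleGroup ↥(maximalRealSubfield L),
        μ (AdeleRing.ideleBaseChange (↥(maximalRealSubfield L)) L x) = quadraticHeckeCharCM L x)
      (hΔ : Δ = finExplicitCollection L H' μ (finExplicitDelta_conj_left_all L H' μ) (finExplicitDelta_conj_right_all L H' μ))
      (hTinf : Tinf = archCanonicalTransferFactor L H' μ),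
              ∀ (γ₀ : (UnitaryGroup.cmDatum L 3 H').Rational) (e₁ e₂ : L), e₁ ≠ e₂ →
                ((((γ₀ : unitaryGroup (cmConjRingHom L) H').val : GL (Fin 3) L) : Matrix (Fin 3) (Fin 3) L) - e₁ • (1 : Matrix (Fin 3) (Fin 3) L)) * ((((γ₀ : unitaryGroup (cmConjRingHom L) H').val : GL (Fin 3) L) : Matrix (Fin 3) (Fin 3) L) - e₂ • (1 : Matrix (Fin 3) (Fin 3) L)) = 0 →
                (¬ ∃ ζ : L, (((γ₀ : unitaryGroup (cmConjRingHom L) H').val : GL (Fin 3) L) : Matrix (Fin 3) (Fin 3) L) = ζ • (1 : Matrix (Fin 3) (Fin 3) L)) →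
                (((γ₀ : unitaryGroup (cmConjRingHom L) H').val : GL (Fin 3) L) : Matrix (Fin 3) (Fin 3) L).charpoly =
                  (Polynomial.X - Polynomial.C e₁) ^ 2 * (Polynomial.X - Polynomial.C e₂) →
                ∀ (γH : (UnitaryGroup.cmDatum L 2 (Matrix.of fun i j : Fin 2 => if i.val + j.val + 1 = 2 then (1 : L) else 0)).Rational ×
                    (UnitaryGroup.cmDatum L 1 (Matrix.of fun i j : Fin 1 => if i.val + j.val + 1 = 1 then (1 : L) else 0)).Rational),
                  (((γH.1 : unitaryGroup (cmConjRingHom L) (Matrix.of fun i j : Fin 2 => if i.val + j.val + 1 = 2 then (1 : L) else 0)).val : GL (Fin 2) L) : Matrix (Fin 2) (Fin 2) L) =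
                    e₁ • (1 : Matrix (Fin 2) (Fin 2) L) →
                  (((γH.2 : unitaryGroup (cmConjRingHom L) (Matrix.of fun i j : Fin 1 => if i.val + j.val + 1 = 1 then (1 : L) else 0)).val : GL (Fin 1) L) : Matrix (Fin 1) (Fin 1) L) 0 0 = e₂ →
                  ∀ (v : HeightOneSpectrum (𝓞 ↥(maximalRealSubfield L))), ∃ (fH : (UnitaryGroup.cmDatum L 2 (Matrix.of fun i j : Fin 2 => if i.val + j.val + 1 = 2 then (1 : L) else 0)).Local v × (UnitaryGroup.cmDatum L 1 (Matrix.of fun i j : Fin 1 => if i.val + j.val + 1 = 1 then (1 : L) else 0)).Local v → ℂ) (f : (UnitaryGroup.cmDatum L 3 H').Local v → ℂ),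
                    IsLocSmooth f ∧ IsLocSmooth fH ∧ IsLocalDeltaTransfer L H' v (Δ v) (mH v) (mG v) fH f ∧ fH ((UnitaryGroup.cmDatum L 2 (Matrix.of fun i j : Fin 2 => if i.val + j.val + 1 = 2 then (1 : L) else 0)).toLocal v ((UnitaryGroup.cmDatum L 2 (Matrix.of fun i j : Fin 2 => if i.val + j.val + 1 = 2 then (1 : L) else 0)).toAdelic γH.1),
                            (UnitaryGroup.cmDatum L 1 (Matrix.of fun i j : Fin 1 => if i.val + j.val + 1 = 1 then (1 : L) else 0)).toLocal v ((UnitaryGroup.cmDatum L 1 (Matrix.of fun i j : Fin 1 => if i.val + j.val + 1 = 1 then (1 : L) else 0)).toAdelic γH.2)) ≠ 0 := by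
  intro hK hanis Sbad Δ mH mG m' m mHi t' t tH hherm hCTM hACS μ hμu hμω hΔ hTinf γ₀ e₁ e₂ hne hprod hnsc hchar γH hγH₁ hγH₂ v
  classical
  by_cases hns : Subsingleton (UnitaryGroup.PlacesOver L v)
  swap
  · -- SPLIT `v`: ★ p854983 (K2E4-p07 (g0)), binders token for token
    exact K2E3GermConstantRegularHRSplit.germConstantRegularHR_of_not_subsingleton L H' Tinf νH νG νGi νqi νHi hK hanis Sbad Δ mH mG m' m mHi t' t tH
      hherm hCTM hACS μ hμu hμω hΔ hTinf γ₀ e₁ e₂ hne hprod hnsc hchar γH hγH₁ hγH₂ v hns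
  -- NON-SPLIT `v` (in or out of `S_bad`): the place `w`, `det H′ ≠ 0`, the pinned factor
  obtain ⟨w⟩ := UnitaryGroup.PlacesOver.nonempty L v
  have hw : IsCMField.complexConj L • w.1 = w.1 := smul_eq_of_subsingleton_placesOver L hns w
  have hdet' : H'.det ≠ 0 := Godement.det_ne_zero_of_anisotropic L H' hanis
  subst hΔ
  -- the canonical families and the existence of transfers, from `hCTM`
  have hex := (hCTM.1 v).1.2.2.2
  have hmH := (hCTM.1 v).2.2.1
  have hmG := (hCTM.1 v).2.2.2
  -- `νH v` is a Haar measure (unimodularity of `H_v` + `νH v ≠ 0` under `hCTM`, as in ★ p854983)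
  have hneH : νH v ≠ 0 := by
    intro hv0
    obtain ⟨γH', -, hreg', -⟩ := K2E4WeakMatrixAlmostEverywhereAgreement.exists_isGRegular_isNormPair (L := L) H' hherm hanis
    have hP := isLocalGRegular_out_mk_rationalComponent L γH' hreg' v
    obtain ⟨t₀, ht₀, hti₀, -, hm⟩ := (hCTM.1 v).2.2.1 _ hP
    have hz := ((hCTM.1 v).1.2.1 _ hP).1
    rw [hm] at hz
    exact hz (quotientMeasure_eq_zero_of_eq_zero _ _ t₀ (νH v) hv0)
  haveI : (νH v).IsHaarMeasure := by
    haveI := K2E4WeakMatrixAlmostEverywhereAgreement.isMulRightInvariant_endoscopicLocal L v (MeasureTheory.Measure.haar : Measure ((UnitaryGroup.cmDatum L 2 (Matrix.of fun i j : Fin 2 => if i.val + j.val + 1 = 2 then (1 : L) else 0)).Local v × (UnitaryGroup.cmDatum L 1 (Matrix.of fun i j : Fin 1 => if i.val + j.val + 1 = 1 then (1 : L) else 0)).Local v))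
    exact isHaarMeasure_of_isMulRightInvariant_of_ne_zero MeasureTheory.Measure.haar (νH v) hneH
  -- the central point `ε_H = γ_{H,v} = (e₁·1₂, e₂)_v` and its scalar `a = (e₁ ⊗ 1)_v`
  set εH : ((UnitaryGroup.cmDatum L 2 (Matrix.of fun i j : Fin 2 => if i.val + j.val + 1 = 2 then (1 : L) else 0)).Local v × (UnitaryGroup.cmDatum L 1 (Matrix.of fun i j : Fin 1 => if i.val + j.val + 1 = 1 then (1 : L) else 0)).Local v) :=
    ((UnitaryGroup.cmDatum L 2 (Matrix.of fun i j : Fin 2 => if i.val + j.val + 1 = 2 then (1 : L) else 0)).toLocal v ((UnitaryGroup.cmDatum L 2 (Matrix.of fun i j : Fin 2 => if i.val + j.val + 1 = 2 then (1 : L) else 0)).toAdelic γH.1),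
      (UnitaryGroup.cmDatum L 1 (Matrix.of fun i j : Fin 1 => if i.val + j.val + 1 = 1 then (1 : L) else 0)).toLocal v ((UnitaryGroup.cmDatum L 1 (Matrix.of fun i j : Fin 1 => if i.val + j.val + 1 = 1 then (1 : L) else 0)).toAdelic γH.2)) with hεHdef
  set a : UnitaryGroup.LocalRing L v := UnitaryGroup.adeleToLocal L v (algebraMap L (AdeleRing (𝓞 L) L) e₁) with hadef
  have ha : (εH.1.val.val : Matrix (Fin 2) (Fin 2) (UnitaryGroup.LocalRing L v)) = a • (1 : Matrix (Fin 2) (Fin 2) (UnitaryGroup.LocalRing L v)) :=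
    coe_coe_cmDatum_toLocal_toAdelic_eq_smul_one_of_smul_one hγH₁ v
  have hu : (εH.2.val.val : Matrix (Fin 1) (Fin 1) (UnitaryGroup.LocalRing L v)) 0 0 ≠ a := by
    intro hua
    apply hne
    have h2 : (εH.2.val.val : Matrix (Fin 1) (Fin 1) (UnitaryGroup.LocalRing L v)) 0 0 = algebraMap L (UnitaryGroup.LocalRing L v) e₂ := by
      change ((((UnitaryGroup.cmDatum L 1 (Matrix.of fun i j : Fin 1 => if i.val + j.val + 1 = 1 then (1 : L) else 0)).toLocal v
        ((UnitaryGroup.cmDatum L 1 (Matrix.of fun i j : Fin 1 => if i.val + j.val + 1 = 1 then (1 : L) else 0)).toAdelic γH.2)).val :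
          GL (Fin 1) (UnitaryGroup.LocalRing L v)).val : Matrix (Fin 1) (Fin 1) (UnitaryGroup.LocalRing L v)) 0 0 = _
      rw [coe_toLocal_toAdelic_eq_map, Matrix.map_apply, hγH₂]
    have h1 : a = algebraMap L (UnitaryGroup.LocalRing L v) e₁ := by
      rw [hadef, ← UnitaryGroup.adeleToLocal_comp_algebraMap (E := L) v, RingHom.comp_apply]
    rw [h2, h1] at hua
    exact ((algebraMap L (UnitaryGroup.LocalRing L v)).injective hua).symm
  have hu₀ : IsUnit ((finCharpolyTwo L v εH).eval (finGammaTwo L v εH)) := isUnit_eval_finCharpolyTwo_of_central L v w hw εH a ha hu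
  -- the central dock at the good class `ε` and a bad frame `P′`
  obtain ⟨ε, y, θ, hmε, hθε, hθ⟩ := exists_centralDock_of_fst_eq_smul_one (L := L) (H' := H') (v := v) w hw hherm hdet' εH a ha hu
  have hy : y * ((endoEmbLocal L v εH).val : GL (Fin 3) (UnitaryGroup.LocalRing L v)) * y⁻¹ = ε.val := by rw [← hθ εH, hθε]
  set Wsw : GL (Fin 3) (UnitaryGroup.LocalRing L v) :=
    ⟨!![(1 : UnitaryGroup.LocalRing L v), 0, 0; 0, 0, 1; 0, 1, 0], !![(1 : UnitaryGroup.LocalRing L v), 0, 0; 0, 0, 1; 0, 1, 0],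
      by simp [Matrix.one_fin_three],
      by simp [Matrix.one_fin_three]⟩ with hWswdef
  have hW : Wsw.val = !![(1 : UnitaryGroup.LocalRing L v), 0, 0; 0, 0, 1; 0, 1, 0] := rfl
  obtain ⟨G₁, G₂, P', G₁', G₂', hPW, hP', hnn⟩ := exists_badFrame_dock (L := L) (H' := H') (v := v) w hw hherm hdet' εH a ha hu hy hW
  -- STEP (ii): near `(ε_H, ε)` every matched element is on the dock side
  obtain ⟨N, hN, U, hU, hdock⟩ := K2E3GermConstantRegularHRDockSideOnly.exists_nhds_not_badFrame_of_isLocalNormPair L H' v hherm hdet' w hw μ εH a ha hu ε y θ hθε hθ hW hPW hP' hnn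
  -- a compact open `U′ ∋ ε` inside `U`; the test function `φ := 1_{U′}`
  haveI : TotallyDisconnectedSpace ((UnitaryGroup.cmDatum L 3 H').Local v) := totallyDisconnectedSpace_cmDatum_local L 3 H' v
  obtain ⟨K, hKc, hKε⟩ := exists_compact_mem_nhds ε
  obtain ⟨U', hU'cl, hεU', hU'sub⟩ := (loc_compact_Haus_tot_disc_of_zero_dim (H := ((UnitaryGroup.cmDatum L 3 H').Local v))).mem_nhds_iff.1
    (inter_mem (interior_mem_nhds.2 hKε) hU)
  have hU'c : IsCompact U' := hKc.of_isClosed_subset hU'cl.1 fun x hx => interior_subset (hU'sub hx).1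
  have hU'U : U' ⊆ U := fun x hx => (hU'sub hx).2
  set φ : ((UnitaryGroup.cmDatum L 3 H').Local v) → ℂ := U'.indicator fun _ => (1 : ℂ) with hφdef
  have hφ : IsLocSmooth φ := isLocSmooth_indicator hU'cl.2 hU'cl.1 hU'c
  -- STEP (i): Harish-Chandra descent of `φ` at `ε` with the witness `φ_ε` and its value `φ_ε(ε_H) ≠ 0`
  obtain ⟨B, hB, hBsat, φε, hφε, hval, hdesc⟩ :=
    K2E3GermConstantRegularHRDescentWitness.exists_nhds_classOrbitalIntegral_dock_eq_indicator_apply_ne_zero L H' v hherm hdet' w hw (νH v) (νG v)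
      hmH hmG εH a ha hu ε y θ hθε hθ hU'c hU'cl.2 hεU'
  -- the `Q′`-side classes near `ε_H` do not see `φ`
  have hQ0 : ∃ V₆ ∈ 𝓝 εH, ∀ γH₁ ∈ V₆, IsLocalGRegular L v γH₁ → ∀ c : ConjClasses ((UnitaryGroup.cmDatum L 3 H').Local v),
      (∃ x : ((UnitaryGroup.cmDatum L 3 H').Local v), ∃ Bm : Matrix (Fin 2) (Fin 2) (UnitaryGroup.LocalRing L v), ((x * Quotient.out c * x⁻¹).val.val : Matrix (Fin 3) (Fin 3) (UnitaryGroup.LocalRing L v)) * P'.val =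
        P'.val * UnitaryGroup.finSum 2 1 Bm (γH₁.2.val.val : Matrix (Fin 1) (Fin 1) (UnitaryGroup.LocalRing L v))) →
      ((finExplicitCollection L H' μ (finExplicitDelta_conj_left_all L H' μ) (finExplicitDelta_conj_right_all L H' μ)) v).Δ γH₁ (Quotient.out c) * classOrbitalIntegral (mG v) φ c = 0 := by
    refine ⟨N, hN, fun γH₁ hγ₁ hreg₁ c hframe => ?_⟩
    by_cases hm : IsLocalNormPair L H' v γH₁ (Quotient.out c)
    · have h0 : classOrbitalIntegral (mG v) φ c = 0 := by
        refine classOrbitalIntegral_eq_zero_of_forall_conj_eq_zero (mG v) φ c fun z => ?_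
        rw [hφdef, Set.indicator_apply_eq_zero]
        intro hz
        exfalso
        obtain ⟨x, Bm, hxB⟩ := hframe
        refine hdock γH₁ hγ₁ hreg₁ (z * Quotient.out c * z⁻¹) (hU'U hz)
          ((isLocalNormPair_conj_right (L := L) (v := v) (H' := H') (a := γH₁) (b := Quotient.out c) (y := z)).2 hm) ⟨x * z⁻¹, Bm, ?_⟩
        have e : x * z⁻¹ * (z * Quotient.out c * z⁻¹) * (x * z⁻¹)⁻¹ = x * Quotient.out c * x⁻¹ := by group
        rw [e]; exact hxB
      rw [h0, mul_zero]
    · rw [finExplicitCollection_Δ, finExplicitDelta_of_not_isLocalNormPair L v H' γH₁ μ hm, zero_mul]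
  -- STEP (iii): the ε-only junction — `(Δ₀ • φ_ε, φ)` satisfies (4.3.1) on some `V ∈ 𝓝 ε_H`
  obtain ⟨V, hV, hident⟩ := K2E3GermConstantRegularHRLocalPair.exists_nhds_stableOrbitalIntegralRel_smul_eq_of_dockSide L H' v hherm hdet' μ
    (finExplicitDelta_conj_left_all L H' μ) (finExplicitDelta_conj_right_all L H' μ) εH ε y θ hθ
    (fun γH₁ g => ∃ Bm : Matrix (Fin 2) (Fin 2) (UnitaryGroup.LocalRing L v),
      (g.val.val : Matrix (Fin 3) (Fin 3) (UnitaryGroup.LocalRing L v)) * P'.val = P'.val * UnitaryGroup.finSum 2 1 Bm (γH₁.2.val.val : Matrix (Fin 1) (Fin 1) (UnitaryGroup.LocalRing L v)))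
    (exists_nhds_stablySaturated_sep_dock w hw εH a ha hu ε y θ hy hθ)
    ⟨Set.univ, Filter.univ_mem, fun γH₁ _ hreg γ' hm => side_of_dock L H' v w hw hherm hdet' εH a ha θ hθ hW hy hPW hP' hnn γH₁ hreg γ' hm⟩
    ⟨Set.univ, Filter.univ_mem, fun γH₁ _ hreg γ' h₁ h₂ => disj_of_dock L H' v θ hθ hW hPW hP' hnn γH₁ hreg γ' h₁ h₂⟩
    φ hφ hB hBsat φε hdesc
    (exists_nhds_finExplicitDelta_dock_eq w hw μ εH a ha hu ε y θ hy hθ)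
    hQ0
  -- STEP (iv) + patch (★ p855254, K2E4-p04 (g2): the clopen stably saturated window + ★ p854913): #7R at `v`
  have hΔ₀ : finExplicitDelta L v H' εH μ ε ≠ 0 := finExplicitDelta_ne_zero_of_isUnit L v H' εH ε μ hmε hu₀
  have hvalH : (finExplicitDelta L v H' εH μ ε • φε) εH ≠ 0 := by rw [Pi.smul_apply, smul_eq_mul]; exact mul_ne_zero hΔ₀ hval
  exact K2E3GermConstantRegularHRNearCentral.exists_transferPair_apply_ne_zero_of_nhds_finExplicitCollection (L := L) (H' := H') (v := v) hns μ
    (finExplicitDelta_conj_left_all L H' μ) (finExplicitDelta_conj_right_all L H' μ) hex hV (hφε.const_smul _) hφ hident hvalH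

end Frame

end Summit.HodgeConjecture.HodgeConjecture.Cruxes.H413.K2E3GermConstantRegularHR

end
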